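import Summits.BirchSwinnertonDyer.BirchSwinnertonDyer.Theorems.KolyvaginRoadThreeSchneiderTamAtThreeHeightLogNumeratorExactPTateApprox
import Summits.BirchSwinnertonDyer.BirchSwinnertonDyer.Theorems.KolyvaginRoadThreeSchneiderTamAtThreeHeightLogNumeratorExactPCheckerRed
import Literature.NumberTheory.EllipticCurves.PAdicHeightsLogProofs
import HarnessLib

/-!
# «The height is the logarithm of the numerator» — part 11a: the curve constants `C⁻²`, `κ_E`, `log_p q_E`
# read off an APPROXIMATE Tate parameter `q̃` (any precision, any `ν`)

HONEST FRAMING (cell `bsd-stepL`, seat `bsd-stepL-tam3-p2` g5, WIDTH-LEVER second lane «closed-form Schneider local factor …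
from the Tate/formal-group parametrisation»; `--supports stmt-BirchSwinnertonDyer-19154 --as helper`): THEOREMS ONLY; 0 definitions,
0 named facts, 0 sorry; nothing class-wide; Schneider's conjecture and BSD asserted nowhere. Route-free.

Parts 6b/8c (the exact row checkers) read the three transcendental-looking constants of the `p`-adic height at a
multiplicative prime — `κ_E = (C⁻²E₂(q) − b₂)/12`, `C⁻²`, `log_p q` — through their FIRST `q`-digits (`1/j`-expansion to
order `q²`), which caps the certifiable level: `k ≤ ν` (non-split), `k + v_L ≤ ν` (split). Part 10 pins `q = q_E` to ANY
precision from `j` (`norm_tateParam_sub_le_of_cert`). This file turns an approximation `q̃` of `q` into approximations of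
the three constants, with explicit error `ε`:
* generic complete ultrametric field: `norm_tateS_sub_tateS_le` (**`s_k` is 1-Lipschitz on the unit disc**),
  `norm_tateS_sub_sum_le_of_near` (`‖s_k(q) − Σ_{n<M}σ_k(n+1)q̃ⁿ⁺¹‖ ≤ max(‖q − q̃‖, ‖q̃‖^{M+1})`);
* `ℚ_p`: `inv_uniformisationScaleSq_eq_padic` (**`C⁻² = −E₄(q)·c₆/(E₆(q)·c₄)` EXACTLY** — `c₄(E_q) = E₄`, `c₆(E_q) = −E₆`),
  `norm_div_sub_div_le_padic`, `norm_inv_uniformisationScaleSq_sub_cert_le_padic` (`‖C⁻² − c̃‖ ≤ ε` from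
  `‖E₄(q) − Ẽ₄‖, ‖E₆(q) − Ẽ₆‖ ≤ ε`), `norm_kappaE_sub_cert_le_padic` (`‖κ-part − (c̃Ẽ₂ − b₂)/12‖ ≤ ε`),
  `padicLog_pow_p_mul_padic` (`log_p(p^ν u) = log_p u`), `norm_padicLog_sub_padicLog_le_padic`
  (**`‖log_p q − log_p q̃‖ ≤ ‖q − q̃‖/‖q̃‖`** when this is `≤ p⁻¹`).
Part 11b assembles the regime-free split checker from these.

References: [SilvermanATAEC1994] Thm. V.3.1; [SilvermanAEC2009] III.1 Table 3.1; [SteinWuthrich2013] §4.2;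
[Iwasawa1972PadicL] §4.4; tree: parts 6b′, 10, Literature `TateCurve/Invariants` (`tateCurve_c₄`, `tateCurve_c₆`),
`PAdicHeightsLogProofs` (`padicLog_mul_holds`, `padicLog_natCast_self_holds`).
-/

noncomputable section

open scoped Classical
open scoped ArithmeticFunction.sigma
open Filter Topology IsUltrametricDist
open WeierstrassCurve Literature.NumberTheory.EllipticCurves
open Literature.NumberTheory.EllipticCurves.SteinWuthrich2013
open Literature.NumberTheory.EllipticCurves.TateCurve
open Literature.NumberTheory.EllipticCurves.Rank1Residual
open Summit.BirchSwinnertonDyer.Uniform.UI.O2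

namespace Summit.BirchSwinnertonDyer.Rank1Residual.X11b.RegMult.HeightLogNumerator

/-! ## Generic field: `s_k` is `1`-Lipschitz on the open unit disc -/

section Generic

variable {K : Type*} [NontriviallyNormedField K] [CompleteSpace K] [IsUltrametricDist K]

/-- **`‖s_k(q) − s_k(q')‖ ≤ ‖q − q'‖`** for `‖q‖, ‖q'‖ < 1`: `s_k(q) − s_k(q') = Σ σ_k(n)(qⁿ − q'ⁿ)` with integer
coefficients and `‖qⁿ − q'ⁿ‖ ≤ ‖q − q'‖`. [cite: SilvermanATAEC1994, Thm. V.3.1] -/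
theorem norm_tateS_sub_tateS_le (k : ℕ) {q q' : K} (hq : ‖q‖ < 1) (hq' : ‖q'‖ < 1) :
    ‖tateS k q - tateS k q'‖ ≤ ‖q - q'‖ := by
  have hs := TateCurve.summable_tateS_term k hq
  have hs' := TateCurve.summable_tateS_term k hq'
  have hdef : tateS k q - tateS k q' = ∑' n : ℕ, ((σ k (n + 1) : ℕ) : K) * (q ^ (n + 1) - q' ^ (n + 1)) := by
    rw [tateS, tateS, ← hs.tsum_sub hs']
    exact tsum_congr fun n ↦ by ring
  rw [hdef]
  refine IsUltrametricDist.norm_tsum_le_of_forall_le_of_nonneg (norm_nonneg _) fun n ↦ ?_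
  rw [norm_mul]
  calc ‖((σ k (n + 1) : ℕ) : K)‖ * ‖q ^ (n + 1) - q' ^ (n + 1)‖ ≤ 1 * ‖q - q'‖ :=
        mul_le_mul (norm_natCast_le_one K _) (norm_pow_sub_pow_le hq.le hq'.le (n + 1)) (norm_nonneg _) zero_le_one
    _ = ‖q - q'‖ := one_mul _

/-- **`‖s_k(q) − Σ_{n<M} σ_k(n+1) q̃ⁿ⁺¹‖ ≤ max(‖q − q̃‖, ‖q̃‖^{M+1})`**: the series at `q` read on a truncation at a nearby `q̃`.
[cite: SilvermanATAEC1994, Thm. V.3.1] -/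
theorem norm_tateS_sub_sum_le_of_near (k M : ℕ) {q q' : K} (hq : ‖q‖ < 1) (hq' : ‖q'‖ < 1) :
    ‖tateS k q - ∑ n ∈ Finset.range M, ((σ k (n + 1) : ℕ) : K) * q' ^ (n + 1)‖ ≤ max ‖q - q'‖ (‖q'‖ ^ (M + 1)) := by
  rw [show tateS k q - ∑ n ∈ Finset.range M, ((σ k (n + 1) : ℕ) : K) * q' ^ (n + 1) =
      (tateS k q - tateS k q') + (tateS k q' - ∑ n ∈ Finset.range M, ((σ k (n + 1) : ℕ) : K) * q' ^ (n + 1)) by ring]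
  exact (norm_add_le_max _ _).trans (max_le_max (norm_tateS_sub_tateS_le k hq hq') (norm_tateS_sub_sum_le k M hq'))

/-- `‖s_k(q)‖ ≤ ‖q‖` for `‖q‖ < 1`. [cite: SilvermanATAEC1994, Thm. V.3.1] -/
theorem norm_tateS_le (k : ℕ) {q : K} (hq : ‖q‖ < 1) : ‖tateS k q‖ ≤ ‖q‖ := by
  have h := norm_tateS_sub_sum_le k 1 hq
  have hone : ∑ n ∈ Finset.range 1, ((σ k (n + 1) : ℕ) : K) * q ^ (n + 1) = q := by
    simp [ArithmeticFunction.sigma_one]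
  rw [hone] at h
  rw [show tateS k q = (tateS k q - q) + q by ring]
  refine (norm_add_le_max _ _).trans (max_le (h.trans ?_) le_rfl)
  calc ‖q‖ ^ (1 + 1) = ‖q‖ * ‖q‖ := by ring
    _ ≤ 1 * ‖q‖ := by gcongr
    _ = ‖q‖ := one_mul _

end Generic

/-! ## `ℚ_p`: the three constants from `q̃` -/

section Padic

variable {p : ℕ} [hp : Fact p.Prime]

/-- **`C⁻² = −E₄(q)·c₆(W)/(E₆(q)·c₄(W))` exactly** (`C² = c₆(E_q)c₄(W)/(c₄(E_q)c₆(W))`, `c₄(E_q) = E₄(q)`,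
`c₆(E_q) = −E₆(q)`). [cite: SteinWuthrich2013, §4.2] [cite: SilvermanAEC2009, III.1 Table 3.1] -/
theorem inv_uniformisationScaleSq_eq_padic (W : WeierstrassCurve ℚ) (q : ℚ_[p]) :
    (uniformisationScaleSq W p q)⁻¹ =
      -(tateE4 q * (W.baseChange ℚ_[p]).c₆) / (tateE6 q * (W.baseChange ℚ_[p]).c₄) := by
  have h12 : (12 : ℚ_[p]) ≠ 0 := by
    have h : ((12 : ℕ) : ℚ_[p]) = 12 := by norm_cast
    rw [← h, Nat.cast_ne_zero]; norm_num
  unfold uniformisationScaleSq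
  rw [inv_div, tateCurve_c₄, tateCurve_c₆ h12, neg_mul, div_neg, ← neg_div]

/-- Ultrametric quotient rule: `‖a/b − a'/b'‖ ≤ ε` when `‖a − a'‖, ‖b − b'‖ ≤ ε`, `‖a'‖ ≤ 1`, `‖b‖ = ‖b'‖ = 1`. [folklore] -/
theorem norm_div_sub_div_le_padic {a a' b b' : ℚ_[p]} {ε : ℝ} (ha : ‖a - a'‖ ≤ ε) (hb : ‖b - b'‖ ≤ ε)
    (ha' : ‖a'‖ ≤ 1) (hbn : ‖b‖ = 1) (hb'n : ‖b'‖ = 1) : ‖a / b - a' / b'‖ ≤ ε := by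
  have hb0 : b ≠ 0 := norm_pos_iff.mp (by rw [hbn]; exact one_pos)
  have hb'0 : b' ≠ 0 := norm_pos_iff.mp (by rw [hb'n]; exact one_pos)
  have e : a / b - a' / b' = ((a - a') * b' + a' * (b' - b)) / (b * b') := by field_simp; ring
  rw [e, norm_div, norm_mul, hbn, hb'n, mul_one, div_one]
  refine (norm_add_le_max _ _).trans (max_le ?_ ?_)
  · rw [norm_mul, hb'n, mul_one]; exact ha
  · rw [norm_mul, norm_sub_rev]
    calc ‖a'‖ * ‖b - b'‖ ≤ 1 * ε := mul_le_mul ha' hb (norm_nonneg _) zero_le_one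
      _ = ε := one_mul ε

/-- `‖E₂(q)‖ ≤ 1` (`E₂ = 1 − 24 s₁`) for `‖q‖ < 1`. [cite: SilvermanATAEC1994, Thm. V.3.1] -/
theorem norm_tateE2_le_one_padic {q : ℚ_[p]} (hq : ‖q‖ < 1) : ‖(1 : ℚ_[p]) - 24 * tateS 1 q‖ ≤ 1 := by
  rw [sub_eq_add_neg]
  refine (norm_add_le_max _ _).trans (max_le (by rw [norm_one]) ?_)
  rw [norm_neg, norm_mul]
  calc ‖(24 : ℚ_[p])‖ * ‖tateS 1 q‖ ≤ 1 * 1 := by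
        refine mul_le_mul ?_ ((norm_tateS_le 1 hq).trans hq.le) (norm_nonneg _) zero_le_one
        exact_mod_cast Padic.norm_int_le_one (p := p) 24
    _ = 1 := one_mul 1

variable {W : WeierstrassCurve ℚ}

/-- **`‖C⁻² − c̃‖ ≤ ε`, `c̃ = −Ẽ₄·c₆/(Ẽ₆·c₄)`**, whenever `‖E₄(q) − Ẽ₄‖, ‖E₆(q) − Ẽ₆‖ ≤ ε < 1` and `c₄, c₆` are `p`-units
(multiplicative reduction). [cite: SteinWuthrich2013, §4.2] -/
theorem norm_inv_uniformisationScaleSq_sub_cert_le_padic [W.IsElliptic] [W.IsGloballyMinimal] (hW : Mult W p)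
    {q : ℚ_[p]} (hq : ‖q‖ < 1) {E4c E6c : ℚ_[p]} {ε : ℝ} (h4 : ‖tateE4 q - E4c‖ ≤ ε) (h6 : ‖tateE6 q - E6c‖ ≤ ε)
    (hε : ε < 1) :
    ‖(uniformisationScaleSq W p q)⁻¹ - -(E4c * (W.baseChange ℚ_[p]).c₆) / (E6c * (W.baseChange ℚ_[p]).c₄)‖ ≤ ε := by
  set V := W.baseChange ℚ_[p] with hVdef
  have hc4 : ‖V.c₄‖ = 1 := by
    have h1 : V.c₄ = (W.c₄ : ℚ_[p]) := (map_c₄ W (algebraMap ℚ ℚ_[p])).trans (eq_ratCast _ _)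
    rw [h1]; exact norm_c₄_eq_one_of_hasMultiplicativeReductionAtPrime hW
  have hc6 : ‖V.c₆‖ = 1 := by
    have h1 : V.c₆ = (W.c₆ : ℚ_[p]) := (map_c₆ W (algebraMap ℚ ℚ_[p])).trans (eq_ratCast _ _)
    rw [h1]; exact norm_c₆_eq_one_of_mult hW
  have hE4 : ‖tateE4 q‖ = 1 := norm_tateE4_eq_one hq
  have hE6 : ‖tateE6 q‖ = 1 := norm_tateE6_eq_one hq
  have near : ∀ {a b : ℚ_[p]}, ‖a‖ = 1 → ‖a - b‖ ≤ ε → ‖b‖ = 1 := by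
    intro a b ha hab
    have hlt : ‖a - b‖ < ‖a‖ := by rw [ha]; exact hab.trans_lt hε
    rw [← ha, show b = a + -(a - b) by ring, norm_add_eq_max_of_norm_ne_norm (by rw [norm_neg]; exact hlt.ne'),
      norm_neg, max_eq_left hlt.le]
  have hE4c : ‖E4c‖ = 1 := near hE4 h4
  have hE6c : ‖E6c‖ = 1 := near hE6 h6
  rw [inv_uniformisationScaleSq_eq_padic, ← hVdef]
  refine norm_div_sub_div_le_padic ?_ ?_ ?_ ?_ ?_
  · rw [show -(tateE4 q * V.c₆) - -(E4c * V.c₆) = -((tateE4 q - E4c) * V.c₆) by ring, norm_neg, norm_mul, hc6,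
      mul_one]; exact h4
  · rw [show tateE6 q * V.c₄ - E6c * V.c₄ = (tateE6 q - E6c) * V.c₄ by ring, norm_mul, hc4, mul_one]; exact h6
  · rw [norm_neg, norm_mul, hE4c, hc6, one_mul]
  · rw [norm_mul, hE6, hc4, one_mul]
  · rw [norm_mul, hE6c, hc4, one_mul]

/-- **`‖κ-part − κ̃‖ ≤ ε`**: with `κ-part = (C⁻²·E₂(q) − b₂)/12` (the coefficient of `den x/num x` in the exact law, part 6)
and `κ̃ = (c̃·Ẽ₂ − b₂)/12` for ANY `c̃`, `Ẽ₂` with `‖C⁻² − c̃‖ ≤ ε`, `‖c̃‖ ≤ 1`, `‖E₂(q) − Ẽ₂‖ ≤ ε` (`p ≥ 5`: `12` is a unit).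
[cite: SteinWuthrich2013, §4.2] -/
theorem norm_kappaE_sub_cert_le_padic (hp5 : 5 ≤ p) (W : WeierstrassCurve ℚ) {q : ℚ_[p]} (hq : ‖q‖ < 1)
    {ct E2c : ℚ_[p]} {ε : ℝ} (hC : ‖(uniformisationScaleSq W p q)⁻¹ - ct‖ ≤ ε) (hct : ‖ct‖ ≤ 1)
    (h2 : ‖((1 : ℚ_[p]) - 24 * tateS 1 q) - E2c‖ ≤ ε) :
    ‖((uniformisationScaleSq W p q)⁻¹ * (1 - 24 * tateS 1 q) - (W.baseChange ℚ_[p]).b₂) / 12 -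
        (ct * E2c - (W.baseChange ℚ_[p]).b₂) / 12‖ ≤ ε := by
  have hp2 : p ≠ 2 := by omega
  have hp3 : p ≠ 3 := by omega
  have h12 : ‖(12 : ℚ_[p])⁻¹‖ = 1 := by
    have hcop2 : Nat.Coprime p 2 := (Nat.coprime_primes hp.out Nat.prime_two).mpr hp2
    have hcop3 : Nat.Coprime p 3 := (Nat.coprime_primes hp.out Nat.prime_three).mpr hp3
    have h12c : Nat.Coprime p 12 := by
      rw [show (12 : ℕ) = 2 ^ 2 * 3 by norm_num]; exact (Nat.Coprime.pow_right 2 hcop2).mul_right hcop3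
    have := Padic.norm_natCast_eq_one_iff.mpr h12c
    rw [norm_inv]; simpa using this
  rw [show ((uniformisationScaleSq W p q)⁻¹ * (1 - 24 * tateS 1 q) - (W.baseChange ℚ_[p]).b₂) / 12 -
      (ct * E2c - (W.baseChange ℚ_[p]).b₂) / 12 =
      (((uniformisationScaleSq W p q)⁻¹ - ct) * (1 - 24 * tateS 1 q) + ct * ((1 - 24 * tateS 1 q) - E2c)) * (12 : ℚ_[p])⁻¹
      by ring, norm_mul, h12, mul_one]
  refine (norm_add_le_max _ _).trans (max_le ?_ ?_)
  · rw [norm_mul]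
    calc ‖(uniformisationScaleSq W p q)⁻¹ - ct‖ * ‖(1 : ℚ_[p]) - 24 * tateS 1 q‖ ≤ ε * 1 :=
          mul_le_mul hC (norm_tateE2_le_one_padic hq) (norm_nonneg _) ((norm_nonneg _).trans hC)
      _ = ε := mul_one ε
  · rw [norm_mul]
    calc ‖ct‖ * ‖((1 : ℚ_[p]) - 24 * tateS 1 q) - E2c‖ ≤ 1 * ε := mul_le_mul hct h2 (norm_nonneg _) zero_le_one
      _ = ε := one_mul ε

/-- `log_p(p^ν · u) = log_p u` (`u ≠ 0`; Iwasawa normalisation `log_p p = 0`). [cite: Iwasawa1972PadicL, §4.4] -/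
theorem padicLog_pow_p_mul_padic (ν : ℕ) {u : ℚ_[p]} (hu : u ≠ 0) :
    padicLog p ((p : ℚ_[p]) ^ ν * u) = padicLog p u := by
  have hp0 : (p : ℚ_[p]) ≠ 0 := Nat.cast_ne_zero.mpr hp.out.ne_zero
  induction ν with
  | zero => rw [pow_zero, one_mul]
  | succ n ih =>
    rw [pow_succ, mul_assoc, mul_comm (p : ℚ_[p]), ← mul_assoc,
      padicLog_mul_holds p (mul_ne_zero (pow_ne_zero _ hp0) hu) hp0, ih]
    have h0 : padicLog p (p : ℚ_[p]) = 0 := padicLog_natCast_self_holds p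
    rw [h0, add_zero]

/-- **`‖log_p q − log_p q̃‖ ≤ ‖q − q̃‖/‖q̃‖`** when `‖q − q̃‖ ≤ p⁻¹‖q̃‖` (`q̃ ≠ 0`): `q = q̃(1 + w)`, `‖w‖ ≤ p⁻¹`,
`‖log_p(1 + w)‖ ≤ ‖w‖`. [cite: Iwasawa1972PadicL, §4.4] -/
theorem norm_padicLog_sub_padicLog_le_padic {q q' : ℚ_[p]} (hq'0 : q' ≠ 0)
    (h : ‖q - q'‖ ≤ (p : ℝ)⁻¹ * ‖q'‖) : ‖padicLog p q - padicLog p q'‖ ≤ ‖q - q'‖ / ‖q'‖ := by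
  have hp1 : (1 : ℝ) < p := by exact_mod_cast hp.out.one_lt
  have hq'n : 0 < ‖q'‖ := norm_pos_iff.mpr hq'0
  set w : ℚ_[p] := (q - q') / q' with hw
  have hwn : ‖w‖ = ‖q - q'‖ / ‖q'‖ := by rw [hw, norm_div]
  have hwp : ‖w‖ ≤ (p : ℝ)⁻¹ := by rw [hwn, div_le_iff₀ hq'n]; exact h
  have hw1 : ‖w‖ < 1 := hwp.trans_lt (inv_lt_one_of_one_lt₀ hp1)
  have h1w : 1 + w ≠ 0 := by
    intro h0
    have : ‖w‖ = 1 := by rw [show w = -1 by linear_combination h0, norm_neg, norm_one]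
    exact hw1.ne this
  have hq : q = q' * (1 + w) := by rw [hw]; field_simp; ring
  have hlog : padicLog p q = padicLog p q' + padicLog p (1 + w) := by
    rw [hq, padicLog_mul_holds p hq'0 h1w]
  have hb := norm_padicLog_one_add_sub_sum_le_padic (p := p) 0 hwp
  simp only [Finset.range_zero, Finset.sum_empty, sub_zero, Nat.cast_zero, zero_add, one_mul, pow_one] at hb
  rw [hlog, add_sub_cancel_left, ← hwn]; exact hb

end Padic

end Summit.BirchSwinnertonDyer.Rank1Residual.X11b.RegMult.HeightLogNumerator

end
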